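import Summits.Langlands.Langlands.Theorems.ExteriorSquareAscentReducibleInducesSquareStubNoPlanesAnalyticOnAxis
import Summits.Langlands.Langlands.Theorems.ExteriorSquareAscentReducibleInducesSquareStubNoPlanesAnalyticOffAxis

/-!
# Stub `stub_noPlanesAnalytic` of line `Sketch` for crux stmt-Langlands-18054 — VI: the stub

(`Summit.Langlands.Langlands.Theses.ExteriorSquareAscent.ReducibleInducesSquare`; serving the glue item
stmt-Langlands-18147 `ReducibleInducesSquareGivenJSAR`.)

**STUB G — no pair-product Hecke character for a cuspidal, NOT essentially self-dual `π` on `GL₄` with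
cuspidal exterior square** (the `(2,2)` case is empty; any number field, no weight hypothesis).  Granting
Jacquet–Shalika (2.2) and (2.3) for Borel–Jacquet data: for `π` cuspidal on `GL₄(𝔸_K)` NOT essentially
self-dual at Satake level, `Π` cuspidal on `GL₆(𝔸_K)` with `t_Π = ∧² t_π` a.e. and a Hecke character `χ`,
it is NOT the case that a.e. `t_{π,v} = β_v ⊔ γ_v` with `|β_v| = 2`, `∏ β_v = χ(ϖ_v)`.  Proof: normalise
`π₀ = π ⊗ ‖·‖^{-σ_ω/4}` (unitary family `α = c·t_π`, `c = q^{σ_ω/4}`), `Π₀ = Π ⊗ ‖·‖^{-σ_ω/2}` (family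
`∧² α`), `π₀^∨` the contragredient datum; NON-essential-self-duality and the splitting transport to `α`
with `χ' = ‖·‖^{-σ_ω/2} χ`, `|χ'| = ‖·‖^{d}`: for `d = 0`, `false_of_unitary_pairChar_twoTwo`; for `d < 0`,
`false_of_large_pairChar_twoTwo` with `χ'`; for `d > 0`, the same with the roles of `β`, `γ` swapped
(`χ'' = ω‖·‖^{-σ_ω/2}χ⁻¹`, `∏ γ = χ''(ϖ)`, `|χ''| = ‖·‖^{-d}`).
-/

set_option linter.dupNamespace false -- `Summit.Langlands.Langlands` is the mandated namespace

noncomputable section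

namespace Summit.Langlands.Langlands.Cruxes.ReducibleInducesSquare.Sketch

open Literature.NumberTheory.GaloisRepresentations Literature.NumberTheory.Automorphic
open NumberField IsDedekindDomain Filter Polynomial
open scoped Classical MatrixGroups NumberField Topology

variable {F : Type} [Field F] [NumberField F] in
/-- `(χ₁ χ₂)(ϖ_v) = χ₁(ϖ_v) χ₂(ϖ_v)`. [folklore] -/
private theorem np_vAU_mul (χ₁ χ₂ : HeckeCharacter F) (v : HeightOneSpectrum (𝓞 F)) :
    (χ₁ * χ₂).valueAtUniformizer v = χ₁.valueAtUniformizer v * χ₂.valueAtUniformizer v := by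
  simp only [Literature.NumberTheory.GaloisRepresentations.HeckeCharacter.valueAtUniformizer,
    Literature.NumberTheory.GaloisRepresentations.HeckeCharacter.localComponent_apply,
    Literature.NumberTheory.GaloisRepresentations.HeckeCharacter.mul_apply, Units.val_mul]

variable {F : Type} [Field F] [NumberField F] in
/-- `χ⁻¹(ϖ_v) = χ(ϖ_v)⁻¹`. [folklore] -/
private theorem np_vAU_inv (χ : HeckeCharacter F) (v : HeightOneSpectrum (𝓞 F)) :
    χ⁻¹.valueAtUniformizer v = (χ.valueAtUniformizer v)⁻¹ := by
  simp only [Literature.NumberTheory.GaloisRepresentations.HeckeCharacter.valueAtUniformizer,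
    Literature.NumberTheory.GaloisRepresentations.HeckeCharacter.localComponent_apply,
    Literature.NumberTheory.GaloisRepresentations.HeckeCharacter.inv_apply, Units.val_inv_eq_inv_val]

variable {F : Type} [Field F] [NumberField F] in
/-- `χ(ϖ_v) ≠ 0`. [folklore] -/
private theorem np_vAU_ne_zero (χ : HeckeCharacter F) (v : HeightOneSpectrum (𝓞 F)) :
    χ.valueAtUniformizer v ≠ 0 := by
  simp only [Literature.NumberTheory.GaloisRepresentations.HeckeCharacter.valueAtUniformizer,
    Literature.NumberTheory.GaloisRepresentations.HeckeCharacter.localComponent_apply]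
  exact Units.ne_zero _

section Main

variable {F : Type} [Field F] [NumberField F]

/-- Essential self-duality at Satake level is stable under twisting: if `(c·M)⁻¹ = e·(c·M)` then
`M⁻¹ = (e c²)·M` (`c ≠ 0`). [folklore] -/
theorem np_map_inv_eq_of_twist {M : Multiset ℂ} {c e : ℂ} (hc : c ≠ 0)
    (h : (M.map (c * ·)).map (·⁻¹) = (M.map (c * ·)).map (e * ·)) :
    M.map (·⁻¹) = M.map ((e * c * c) * ·) := by
  have h' := congrArg (Multiset.map (c * ·)) h
  simp only [Multiset.map_map, Function.comp_def] at h'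
  calc M.map (·⁻¹) = M.map (fun a => c * (c * a)⁻¹) :=
        Multiset.map_congr rfl fun a _ => by rw [mul_inv, ← mul_assoc, mul_inv_cancel₀ hc, one_mul]
    _ = M.map (fun a => c * (e * (c * a))) := h'
    _ = M.map ((e * c * c) * ·) := Multiset.map_congr rfl fun a _ => by ring

/-- **STUB G** (module docstring). [cite: Shavali2026, Prop. 4.2]
[cite: ArthurClozelAMS120, Ch. 3 §2 (2.1)–(2.3)] [cite: JacquetShalikaAJM1981II, Prop. 3.6 and Thm. 4.4] -/
theorem stub_noPlanesAnalytic :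
    ∀ (K : Type) [Field K] [NumberField K]
      (hcpt : Literature.NumberTheory.Automorphic.isCompact_glFiniteIntegralLevel 4 K)
      (h6 : Literature.NumberTheory.Automorphic.isCompact_glFiniteIntegralLevel 6 K)
      (π : Literature.NumberTheory.Automorphic.CuspidalAutomorphicRepData 4 K hcpt)
      (P6 : Literature.NumberTheory.Automorphic.CuspidalAutomorphicRepData 6 K h6),
      Literature.NumberTheory.Automorphic.JacquetShalika1981_partialPairL_boundary_repData →
      Literature.NumberTheory.Automorphic.JacquetShalika1981_partialPairL_pole_repData →
      (∀ᶠ v : IsDedekindDomain.HeightOneSpectrum (NumberField.RingOfIntegers K) in Filter.cofinite,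
        ∀ α : Multiset ℂ, π.1.HasSatakeParamAt v α →
          P6.1.HasSatakeParamAt v (Literature.NumberTheory.Automorphic.wedgeTwoParams α)) →
      (¬ ∃ e : Literature.NumberTheory.GaloisRepresentations.HeckeCharacter K,
          ∀ᶠ v : IsDedekindDomain.HeightOneSpectrum (NumberField.RingOfIntegers K) in Filter.cofinite,
            ∀ α : Multiset ℂ, π.1.HasSatakeParamAt v α →
              α.map (fun a => a⁻¹) = α.map (fun a => e.valueAtUniformizer v * a)) →
      ∀ χ : Literature.NumberTheory.GaloisRepresentations.HeckeCharacter K,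
        ¬ (∀ᶠ v : IsDedekindDomain.HeightOneSpectrum (NumberField.RingOfIntegers K) in Filter.cofinite,
            ∀ α : Multiset ℂ, π.1.HasSatakeParamAt v α →
              ∃ β γ : Multiset ℂ, β + γ = α ∧ Multiset.card β = 2 ∧
                β.prod = χ.valueAtUniformizer v) := by
  intro K _ _ hcpt h6 π P6 hJ2 hJ3 hP6 hNE χ hχ
  haveI : NeZero (4 : ℕ) := ⟨by norm_num⟩
  haveI : NeZero (6 : ℕ) := ⟨by norm_num⟩
  -- the central character of `π` and the real exponents of `|ω_π|`, `|χ|`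
  obtain ⟨Ω, hΩ⟩ := centralCharacter_satake_of_cuspidal π
  obtain ⟨σΩ, hσΩ⟩ := Ω.exists_norm_apply_eq_ideleNorm_rpow
  obtain ⟨σχ, hσχ⟩ := χ.exists_norm_apply_eq_ideleNorm_rpow
  have hnΩ : ∀ w, ‖Ω.valueAtUniformizer w‖ = (w.residueCard : ℝ) ^ (-σΩ) :=
    norm_valueAtUniformizer_eq_rpow_neg_of_norm_apply hσΩ
  -- the unitary normalisation `P = π ⊗ ‖·‖^{-σΩ/4}`, `P₆ = Π ⊗ ‖·‖^{-σΩ/2}`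
  obtain ⟨lam, hlam⟩ := exists_heckeCharacter_ideleNorm_cpow K (((-(σΩ / 4)) : ℝ) : ℂ)
  have hNpos : ∀ x : ideleGroup K, (0 : ℝ) < Literature.NumberTheory.GaloisRepresentations.ideleNorm x :=
    fun x => Literature.NumberTheory.GaloisRepresentations.HeckeCharacter.ideleNorm_pos' K x
  have hnlam : ∀ x : ideleGroup K, ‖((lam x : ℂˣ) : ℂ)‖ =
      Literature.NumberTheory.GaloisRepresentations.ideleNorm x ^ (-(σΩ / 4)) := fun x => by
    rw [hlam x, Complex.norm_cpow_eq_rpow_re_of_pos (hNpos x), Complex.ofReal_re]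
  have hnlamw : ∀ w, ‖lam.valueAtUniformizer w‖ = (w.residueCard : ℝ) ^ (σΩ / 4) := fun w => by
    rw [norm_valueAtUniformizer_eq_rpow_neg_of_norm_apply hnlam, neg_neg]
  obtain ⟨P, hP⟩ := CuspidalAutomorphicRepData.exists_twist_hecke_hasSatakeParamAt lam π
  obtain ⟨Pd, hPd⟩ := CuspidalAutomorphicRepData.exists_contragredient_satake_holds hcpt P
  obtain ⟨P₆, hP₆⟩ := CuspidalAutomorphicRepData.exists_twist_hecke_hasSatakeParamAt (lam * lam) P6
  obtain ⟨απ, eπ⟩ := exists_satakeFamily_eventually_hasSatakeParamAt π.1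
  set α : SatakeFamily K := fun w => (απ w).map (lam.valueAtUniformizer w * ·) with hαdef
  have hPα : ∀ᶠ w : HeightOneSpectrum (𝓞 K) in cofinite, P.1.HasSatakeParamAt w (α w) := by
    filter_upwards [eπ, hP] with w hw hPw
    exact hPw _ hw
  have hPdα : ∀ᶠ w : HeightOneSpectrum (𝓞 K) in cofinite, Pd.1.HasSatakeParamAt w ((α w).map (·⁻¹)) :=
    hPα.mono fun w hw => hPd w _ hw
  have hP₆α : ∀ᶠ w : HeightOneSpectrum (𝓞 K) in cofinite,
      P₆.1.HasSatakeParamAt w (wedgeTwoParams (α w)) := by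
    filter_upwards [eπ, hP6, hP₆] with w hw h6w hP₆w
    have h := hP₆w _ (h6w _ hw)
    rw [np_vAU_mul, ← pow_two, ← wedgeTwoParams_map_mul] at h
    exact h
  have huα : ∀ᶠ w : HeightOneSpectrum (𝓞 K) in cofinite, ‖(α w).prod‖ = 1 := by
    filter_upwards [eπ, hΩ] with w hw hΩw
    have hq : (0 : ℝ) < w.residueCard := by exact_mod_cast lt_trans zero_lt_one w.one_lt_residueCard
    show ‖((απ w).map (lam.valueAtUniformizer w * ·)).prod‖ = 1
    rw [prod_map_const_mul_eq, hw.card_eq, ← hΩw _ hw, norm_mul, norm_pow, hnlamw, hnΩ,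
      ← Real.rpow_natCast, ← Real.rpow_mul hq.le, ← Real.rpow_add hq,
      show σΩ / 4 * ((4 : ℕ) : ℝ) + -σΩ = 0 by push_cast; ring, Real.rpow_zero]
  -- NON-essential-self-duality of the normalised datum
  have hNE' : ¬ ∃ e : HeckeCharacter K, ∀ᶠ w : HeightOneSpectrum (𝓞 K) in cofinite,
      (α w).map (·⁻¹) = (α w).map (e.valueAtUniformizer w * ·) := by
    rintro ⟨e, he⟩
    refine hNE ⟨e * lam * lam, ?_⟩
    filter_upwards [he, eπ] with w hw hπw α' hα'
    have hαα : α' = απ w := π.1.hasSatakeParamAt_unique_holds hα' hπw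
    subst hαα
    rw [np_vAU_mul, np_vAU_mul]
    exact np_map_inv_eq_of_twist (np_vAU_ne_zero lam w) hw
  -- the splitting of `α` by `χ' = ‖·‖^{-σΩ/2} χ`, and the swapped splitting by `χ'' = ω ‖·‖^{-σΩ/2} χ⁻¹`
  set χ' : HeckeCharacter K := lam * lam * χ with hχ'def
  set χ'' : HeckeCharacter K := Ω * lam * lam * χ⁻¹ with hχ''def
  have hsplit' : ∀ᶠ w : HeightOneSpectrum (𝓞 K) in cofinite, ∃ β γ : Multiset ℂ,
      β + γ = α w ∧ Multiset.card β = 2 ∧ β.prod = χ'.valueAtUniformizer w := by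
    filter_upwards [hχ, eπ] with w hw hπw
    obtain ⟨β₀, γ₀, hβγ, hβ2, hx⟩ := hw _ hπw
    refine ⟨β₀.map (lam.valueAtUniformizer w * ·), γ₀.map (lam.valueAtUniformizer w * ·), ?_, ?_, ?_⟩
    · show _ = (απ w).map (lam.valueAtUniformizer w * ·)
      rw [← Multiset.map_add, hβγ]
    · rw [Multiset.card_map, hβ2]
    · rw [prod_map_const_mul_eq, hβ2, hx, hχ'def, np_vAU_mul, np_vAU_mul]
      ring
  have hsplit'' : ∀ᶠ w : HeightOneSpectrum (𝓞 K) in cofinite, ∃ β γ : Multiset ℂ,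
      β + γ = α w ∧ Multiset.card β = 2 ∧ β.prod = χ''.valueAtUniformizer w := by
    filter_upwards [hχ, eπ, hΩ] with w hw hπw hΩw
    obtain ⟨β₀, γ₀, hβγ, hβ2, hx⟩ := hw _ hπw
    have hγ2 : Multiset.card γ₀ = 2 := by
      have h4 := hπw.card_eq
      rw [← hβγ, Multiset.card_add, hβ2] at h4
      omega
    have hx0 : χ.valueAtUniformizer w ≠ 0 := np_vAU_ne_zero χ w
    have hy : γ₀.prod = Ω.valueAtUniformizer w * (χ.valueAtUniformizer w)⁻¹ := by
      rw [hΩw _ hπw, ← hβγ, Multiset.prod_add, hx]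
      field_simp
    refine ⟨γ₀.map (lam.valueAtUniformizer w * ·), β₀.map (lam.valueAtUniformizer w * ·), ?_, ?_, ?_⟩
    · show _ = (απ w).map (lam.valueAtUniformizer w * ·)
      rw [← Multiset.map_add, add_comm, hβγ]
    · rw [Multiset.card_map, hγ2]
    · rw [prod_map_const_mul_eq, hγ2, hy, hχ''def, np_vAU_mul, np_vAU_mul, np_vAU_mul, np_vAU_inv]
      ring
  -- the slopes: `|χ'| = ‖·‖^{d}`, `|χ''| = ‖·‖^{-d}`, `d = σχ - σΩ/2`
  have hnχ' : ∀ x : ideleGroup K, ‖((χ' x : ℂˣ) : ℂ)‖ =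
      Literature.NumberTheory.GaloisRepresentations.ideleNorm x ^ (σχ - σΩ / 2) := fun x => by
    rw [hχ'def, Literature.NumberTheory.GaloisRepresentations.HeckeCharacter.mul_apply,
      Literature.NumberTheory.GaloisRepresentations.HeckeCharacter.mul_apply, Units.val_mul, Units.val_mul,
      norm_mul, norm_mul, hnlam x, hσχ x, ← Real.rpow_add (hNpos x), ← Real.rpow_add (hNpos x)]
    congr 1
    ring
  have hnχ'' : ∀ x : ideleGroup K, ‖((χ'' x : ℂˣ) : ℂ)‖ =
      Literature.NumberTheory.GaloisRepresentations.ideleNorm x ^ (-(σχ - σΩ / 2)) := fun x => by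
    rw [hχ''def, Literature.NumberTheory.GaloisRepresentations.HeckeCharacter.mul_apply,
      Literature.NumberTheory.GaloisRepresentations.HeckeCharacter.mul_apply,
      Literature.NumberTheory.GaloisRepresentations.HeckeCharacter.mul_apply,
      Literature.NumberTheory.GaloisRepresentations.HeckeCharacter.inv_apply, Units.val_mul, Units.val_mul,
      Units.val_mul, Units.val_inv_eq_inv_val, norm_mul, norm_mul, norm_mul, norm_inv, hnlam x, hσχ x, hσΩ x,
      ← Real.rpow_neg (hNpos x).le, ← Real.rpow_add (hNpos x), ← Real.rpow_add (hNpos x),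
      ← Real.rpow_add (hNpos x)]
    congr 1
    ring
  rcases lt_trichotomy (σχ - σΩ / 2) 0 with hlt | heq | hgt
  · -- `d < 0`: `|χ'(ϖ)| = q^{-d} > 1`
    exact false_of_large_pairChar_twoTwo hJ2 hJ3 P Pd P₆ α hPα hPdα hP₆α huα χ' (t := -(σχ - σΩ / 2))
      (by linarith) (fun x => by rw [hnχ' x, neg_neg]) hsplit'
  · -- `d = 0`: `χ'` is unitary at every uniformizer
    refine false_of_unitary_pairChar_twoTwo hJ2 hJ3 P Pd P₆ α hPα hPdα hP₆α huα hNE' χ' (fun w => ?_)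
      hsplit'
    rw [norm_valueAtUniformizer_eq_rpow_neg_of_norm_apply hnχ', heq, neg_zero, Real.rpow_zero]
  · -- `d > 0`: swap the two pairs, `∏ γ = χ''(ϖ)` with `|χ''(ϖ)| = q^{d} > 1`
    exact false_of_large_pairChar_twoTwo hJ2 hJ3 P Pd P₆ α hPα hPdα hP₆α huα χ'' (t := σχ - σΩ / 2) hgt
      hnχ'' hsplit''

end Main

end Summit.Langlands.Langlands.Cruxes.ReducibleInducesSquare.Sketch

end
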